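import Literature.Geometry.Hyperkaehler.IsotropyAlgebraAction
import HarnessLib

/-!
# The Kähler forms of the induced complex structures span the adjoint representation of the isotropy algebra
# `𝔤_M = 𝔰𝔲(2)`: `ad λ_x ω_{λ_y} = −2 ω_{λ_{x×y}}` (Verbitsky 1996, proof of Lemma 2.1), pointwise

Topic `Literature/Geometry/Hyperkaehler`, namespace `Literature.Geometry.Hyperkaehler.IsLinearHyperkaehler` (carrier
`IsLinearHyperkaehler g₀ J` of `ComplexTorusHyperkaehler.lean`; fundamental forms `ω_A = fundamentalForm g₀ A`,
twistor operators `λ_x = x₀I + x₁J + x₂K`). Lane `lit-hodgefound` (Track 2 foundations library), prover seat p06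
(generation 14), self-proposed row g14-#3; uses row g14-#1 (`adAlt` = Verbitsky's `ad`, FILE 1
`LinearAlgebra/Alternating/DerivationExtension.lean`; the `𝔰𝔲(2)` relations of FILE 2 `IsotropyAlgebraAction.lean`).

## Source, verbatim (M. Verbitsky, *Hyperholomorphic bundles over a hyperkähler manifold*, J. Alg. Geom. 5 (1996)
= alg-geom/9307008, §2, proof of Lemma 2.1; held `paper:arxiv-alg-geom_9307008` p0003 L20–L56)

"Lemma 2.1 Let `Θ` be a `G_M`-invariant section of `Λ²(M) ⊗ End(B)`. Then `Λ_L(Θ) = 0` for each induced complex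
structure `L`. […] Consider the bundle `R ⊂ Λ²(M) ⊗ End(B)` spanned by the Kähler forms `ω_L`, for all induced
complex structures `L` on `M`. The element of a group `G_M` maps each of these forms into a linear combination of
these forms. This could be proven by a direct computation. Therefore, `R` is invariant with respect to the
`G_M`-action. Moreover, no section of `R` is `G_M`-invariant. This is proven by another direct computation. Both
of these computations are based on the fact that `R` is a trivial bundle over `M` with a fiber `𝔤_M`, and `G_M`
acts on `R` by means of adjoint representation on `𝔤_M`."

## What is formalised (the two "direct computations", at the Lie-algebra level; theorems only, no definition,
no named fact, no `sorry`)

* §1 `adAlt_fundamentalForm`: for a `g₀`-skew endomorphism `S` and any `A`, `ad S (ω_A) = ω_{A∘S − S∘A}` — the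
  derivation action on `ω_A(v,w) = ½(g₀(Av,w) − g₀(Aw,v))` is the commutator action on `A`.
* §2 **`adAlt_twistorOp_fundamentalForm_twistorOp`**: `ad λ_x ω_{λ_y} = −2 ω_{λ_{x×y}}` for all `x, y ∈ ℝ³` —
  under `y ↦ ω_{λ_y}`, `R ≅ ℝ³` and `ad λ_x` acts as `y ↦ −2 x × y`, the adjoint representation of
  `𝔰𝔲(2) ≅ (ℝ³, ×)` ("`G_M` acts on `R` by means of adjoint representation on `𝔤_M`"); in particular
  `adAlt_twistorOp_fundamentalForm_self` (`ad λ_x ω_{λ_x} = 0`: each `ω_L` is of type `(1,1)` for its own `L`),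
  `adAlt_opI_fundamentalForm_opI` / `adAlt_J_fundamentalForm_J` / `adAlt_opK_fundamentalForm_opK` (`= 0`) and the six
  off-diagonal values `ad I ω_J = −2ω_K`, `ad J ω_K = −2ω_I`, `ad K ω_I = −2ω_J`, `ad I ω_K = 2ω_J`, `ad J ω_I = 2ω_K`
  (`adAlt_opI_fundamentalForm_J`, `adAlt_J_fundamentalForm_opK`, `adAlt_opK_fundamentalForm_opI`,
  `adAlt_opI_fundamentalForm_opK`, `adAlt_J_fundamentalForm_opI`).
* §3 **`adAlt_twistorOp_mem_span`** ("maps each of these forms into a linear combination of these forms":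
  `R = span{ω_I, ω_J, ω_K}` is `𝔤_M`-stable); `fundamentalForm_twistorOp_apply_self_twistorOp`
  (`ω_{λ_z}(v, λ_z v) = |z|² g₀(v,v)`), `eq_zero_of_fundamentalForm_twistorOp_eq_zero` (`z ↦ ω_{λ_z}` is injective on
  a non-zero space: "`R` … with a fiber `𝔤_M`"), and **`eq_zero_of_mem_span_of_adAlt_eq_zero`** ("no section of
  `R` is `G_M`-invariant": `ω ∈ R`, `ad I ω = 0 = ad J ω` ⟹ `ω = 0`).

SCOPE NOTES. (i) Pointwise, scalar-valued (`ℝ`) fundamental forms; the `End(B)`-valued version of the source is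
`R ⊗ End(B)` and is not spelled out. (ii) Group versus algebra: the source speaks of the group `G_M`; here the
statements are for its Lie algebra (FILE 1's convention: `[ad I, ad J] = −2 ad K`), which is what "direct
computation" computes; the orthogonality conclusion of Lemma 2.1 itself (`Λ_L Θ = 0`) is row Q1383
(`HyperholomorphicYangMills.lean`) and is not re-proved. (iii) `E ≠ 0` (`[Nontrivial E]`) is needed for
"no invariants", as `R = 0` on the zero space.

## References

* [Verbitsky1996Hyperholomorphic] M. Verbitsky, J. Alg. Geom. 5 (1996) 633–669 = alg-geom/9307008, §2 Lemma 2.1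
  and its proof; §1 (the Kähler forms `ω_L` of the induced complex structures).
* [Joyce2007] D. Joyce, *Riemannian Holonomy Groups and Calibrated Geometry* (2007), §10.1.1 eq. (10.1) (the
  triple `ω₁, ω₂, ω₃`; the tree's `fundamentalForm`).
* [Huybrechts2016K3] D. Huybrechts, *Lectures on K3 Surfaces* (2016), Ch. 7 §3.2 (`ω_λ = aω_I + bω_J + cω_K`).
-/

noncomputable section

open scoped Matrix
open Complex Function Finset Literature.LinearAlgebra.Alternating

namespace Literature.Geometry.Hyperkaehler

variable {E : Type*} [NormedAddCommGroup E] [NormedSpace ℂ E]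
  {g₀ : E →L[ℝ] E →L[ℝ] ℝ} {J : E →L[ℝ] E}

/-! ## §1 `ad S ω_A = ω_{AS − SA}` for a `g₀`-skew `S` -/

/-- **`ad S` of a fundamental form**: for an endomorphism `S` that is skew for `g₀` (`g₀(Sv, w) = −g₀(v, Sw)`) and
any `A`, `ad S (ω_A) = ω_{A∘S − S∘A}` where `ω_A(v, w) = ½(g₀(Av, w) − g₀(Aw, v))` (`fundamentalForm`): the
derivation action on `2`-forms is the commutator action on the endomorphism ("`G_M` acts on `R` by means of
adjoint representation on `𝔤_M`", infinitesimally). [cite: Verbitsky1996Hyperholomorphic, §2 Lemma 2.1 (proof)] -/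
theorem adAlt_fundamentalForm {S : E →L[ℝ] E} (hS : ∀ v w : E, g₀ (S v) w = -g₀ v (S w)) (A : E →L[ℝ] E) :
    adAlt S (fundamentalForm g₀ A) = fundamentalForm g₀ (A.comp S - S.comp A) := by
  ext v
  have hv : v = ![v 0, v 1] := by
    ext i
    fin_cases i <;> rfl
  rw [hv, adAlt_apply_two, fundamentalForm_apply, fundamentalForm_apply, fundamentalForm_apply]
  simp only [sub_apply, ContinuousLinearMap.comp_apply, map_sub, hS (A (v 1)) (v 0), hS (A (v 0)) (v 1)]
  ring

/-- `ω_0 = 0`. [cite: Huybrechts2016K3, Ch. 7 §3.2] -/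
private theorem fundamentalForm_zero' (g₀ : E →L[ℝ] E →L[ℝ] ℝ) : fundamentalForm g₀ (0 : E →L[ℝ] E) = 0 := by
  simpa using fundamentalForm_smul g₀ (0 : ℝ) (opI E)

/-- `ω_{−A} = −ω_A`. [cite: Huybrechts2016K3, Ch. 7 §3.2] -/
private theorem fundamentalForm_neg' (g₀ : E →L[ℝ] E →L[ℝ] ℝ) (A : E →L[ℝ] E) :
    fundamentalForm g₀ (-A) = -fundamentalForm g₀ A := by
  ext v
  rw [ContinuousAlternatingMap.neg_apply, fundamentalForm_apply', fundamentalForm_apply']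
  simp only [neg_apply, map_neg]
  ring

namespace IsLinearHyperkaehler

/-! ## §2 The triple `ω_I, ω_J, ω_K` under `ad I, ad J, ad K` -/

/-- **`ad λ_x ω_{λ_y} = −2 ω_{λ_{x×y}}`**: on the span `R` of the Kähler forms of the induced complex structures the
isotropy algebra acts through the cross product, i.e. by the adjoint representation of `𝔰𝔲(2) ≅ (ℝ³, ×)` ("`R` is a
trivial bundle over `M` with a fiber `𝔤_M`, and `G_M` acts on `R` by means of adjoint representation on `𝔤_M`";
"The element of a group `G_M` maps each of these forms into a linear combination of these forms. This could be
proven by a direct computation"). [cite: Verbitsky1996Hyperholomorphic, §2 Lemma 2.1 (proof)] -/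
theorem adAlt_twistorOp_fundamentalForm_twistorOp (h : IsLinearHyperkaehler g₀ J) (x y : Fin 3 → ℝ) :
    adAlt (x 0 • opI E + x 1 • J + x 2 • opK J) (fundamentalForm g₀ (y 0 • opI E + y 1 • J + y 2 • opK J)) =
      (-2 : ℝ) • fundamentalForm g₀ ((x ⨯₃ y) 0 • opI E + (x ⨯₃ y) 1 • J + (x ⨯₃ y) 2 • opK J) := by
  rw [adAlt_fundamentalForm (fun v w ↦ h.inner_twistor_left (x 0) (x 1) (x 2) v w), h.twistorOp_comp_sub_comp x y,
    ← neg_smul, fundamentalForm_smul]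

/-- **Every `ω_λ` is annihilated by its own `ad λ`** (`x × x = 0`): `ω_L` is of type `(1,1)` with respect to `L`
(FILE 1 `adAlt_eq_zero_iff_isOfTypeAt` read on `(E, L)`; in degree `2`, `L`-invariance `ω_L(L·, L·) = ω_L`).
[cite: Verbitsky1996Hyperholomorphic, §1 (ω_L is the Kähler form of (M, L))] -/
theorem adAlt_twistorOp_fundamentalForm_self (h : IsLinearHyperkaehler g₀ J) (x : Fin 3 → ℝ) :
    adAlt (x 0 • opI E + x 1 • J + x 2 • opK J) (fundamentalForm g₀ (x 0 • opI E + x 1 • J + x 2 • opK J)) = 0 := by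
  rw [h.adAlt_twistorOp_fundamentalForm_twistorOp, cross_self]
  simp only [Pi.zero_apply, zero_smul, add_zero, fundamentalForm_zero', smul_zero]

/-- `ad I ω_I = 0`. [cite: Verbitsky1996Hyperholomorphic, §1 (ω_I is the Kähler form)] -/
theorem adAlt_opI_fundamentalForm_opI (h : IsLinearHyperkaehler g₀ J) : adAlt (opI E) (fundamentalForm g₀ (opI E)) = 0 := by
  simpa using h.adAlt_twistorOp_fundamentalForm_self ![1, 0, 0]

/-- `ad J ω_J = 0`. [cite: Verbitsky1996Hyperholomorphic, §1 (ω_J is the Kähler form of (M, J))] -/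
theorem adAlt_J_fundamentalForm_J (h : IsLinearHyperkaehler g₀ J) : adAlt J (fundamentalForm g₀ J) = 0 := by
  simpa using h.adAlt_twistorOp_fundamentalForm_self ![0, 1, 0]

/-- `ad K ω_K = 0`. [cite: Verbitsky1996Hyperholomorphic, §1 (ω_K is the Kähler form of (M, K))] -/
theorem adAlt_opK_fundamentalForm_opK (h : IsLinearHyperkaehler g₀ J) :
    adAlt (opK J) (fundamentalForm g₀ (opK J)) = 0 := by
  simpa using h.adAlt_twistorOp_fundamentalForm_self ![0, 0, 1]

/-- `ad I ω_J = −2 ω_K`. [cite: Verbitsky1996Hyperholomorphic, §2 Lemma 2.1 (proof: adjoint representation on 𝔤_M)] -/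
theorem adAlt_opI_fundamentalForm_J (h : IsLinearHyperkaehler g₀ J) :
    adAlt (opI E) (fundamentalForm g₀ J) = (-2 : ℝ) • fundamentalForm g₀ (opK J) := by
  simpa [cross_apply] using h.adAlt_twistorOp_fundamentalForm_twistorOp ![1, 0, 0] ![0, 1, 0]

/-- `ad J ω_K = −2 ω_I`. [cite: Verbitsky1996Hyperholomorphic, §2 Lemma 2.1 (proof: adjoint representation on 𝔤_M)] -/
theorem adAlt_J_fundamentalForm_opK (h : IsLinearHyperkaehler g₀ J) :
    adAlt J (fundamentalForm g₀ (opK J)) = (-2 : ℝ) • fundamentalForm g₀ (opI E) := by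
  simpa [cross_apply] using h.adAlt_twistorOp_fundamentalForm_twistorOp ![0, 1, 0] ![0, 0, 1]

/-- `ad K ω_I = −2 ω_J`. [cite: Verbitsky1996Hyperholomorphic, §2 Lemma 2.1 (proof: adjoint representation on 𝔤_M)] -/
theorem adAlt_opK_fundamentalForm_opI (h : IsLinearHyperkaehler g₀ J) :
    adAlt (opK J) (fundamentalForm g₀ (opI E)) = (-2 : ℝ) • fundamentalForm g₀ J := by
  simpa [cross_apply] using h.adAlt_twistorOp_fundamentalForm_twistorOp ![0, 0, 1] ![1, 0, 0]

/-- `ad I ω_K = 2 ω_J`. [cite: Verbitsky1996Hyperholomorphic, §2 Lemma 2.1 (proof: adjoint representation on 𝔤_M)] -/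
theorem adAlt_opI_fundamentalForm_opK (h : IsLinearHyperkaehler g₀ J) :
    adAlt (opI E) (fundamentalForm g₀ (opK J)) = (2 : ℝ) • fundamentalForm g₀ J := by
  simpa [cross_apply, fundamentalForm_neg'] using h.adAlt_twistorOp_fundamentalForm_twistorOp ![1, 0, 0] ![0, 0, 1]

/-- `ad J ω_I = 2 ω_K`. [cite: Verbitsky1996Hyperholomorphic, §2 Lemma 2.1 (proof: adjoint representation on 𝔤_M)] -/
theorem adAlt_J_fundamentalForm_opI (h : IsLinearHyperkaehler g₀ J) :
    adAlt J (fundamentalForm g₀ (opI E)) = (2 : ℝ) • fundamentalForm g₀ (opK J) := by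
  simpa [cross_apply, fundamentalForm_neg'] using h.adAlt_twistorOp_fundamentalForm_twistorOp ![0, 1, 0] ![1, 0, 0]

/-! ## §3 `R = span{ω_I, ω_J, ω_K}` is `𝔤_M`-stable and has no non-zero invariants -/

/-- **`R` is stable under the isotropy algebra**: `ad λ_x` maps the span of `ω_I, ω_J, ω_K` into itself ("The
element of a group `G_M` maps each of these forms into a linear combination of these forms").
[cite: Verbitsky1996Hyperholomorphic, §2 Lemma 2.1 (proof)] -/
theorem adAlt_twistorOp_mem_span (h : IsLinearHyperkaehler g₀ J) (x : Fin 3 → ℝ) {ω : E [⋀^Fin 2]→L[ℝ] ℝ}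
    (hω : ω ∈ Submodule.span ℝ {fundamentalForm g₀ (opI E), fundamentalForm g₀ J, fundamentalForm g₀ (opK J)}) :
    adAlt (x 0 • opI E + x 1 • J + x 2 • opK J) ω ∈
      Submodule.span ℝ {fundamentalForm g₀ (opI E), fundamentalForm g₀ J, fundamentalForm g₀ (opK J)} := by
  refine Submodule.span_induction (p := fun ω _ ↦ adAlt (x 0 • opI E + x 1 • J + x 2 • opK J) ω ∈
      Submodule.span ℝ {fundamentalForm g₀ (opI E), fundamentalForm g₀ J, fundamentalForm g₀ (opK J)}) ?_ ?_ ?_ ?_ hω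
  · intro η hη
    have key : ∀ y : Fin 3 → ℝ, adAlt (x 0 • opI E + x 1 • J + x 2 • opK J)
        (fundamentalForm g₀ (y 0 • opI E + y 1 • J + y 2 • opK J)) ∈
        Submodule.span ℝ {fundamentalForm g₀ (opI E), fundamentalForm g₀ J, fundamentalForm g₀ (opK J)} := by
      intro y
      rw [h.adAlt_twistorOp_fundamentalForm_twistorOp, fundamentalForm_twistor]
      refine Submodule.smul_mem _ _ (Submodule.add_mem _ (Submodule.add_mem _
        (Submodule.smul_mem _ _ (Submodule.subset_span (by simp)))
        (Submodule.smul_mem _ _ (Submodule.subset_span (by simp))))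
        (Submodule.smul_mem _ _ (Submodule.subset_span (by simp))))
    simp only [Set.mem_insert_iff, Set.mem_singleton_iff] at hη
    rcases hη with rfl | rfl | rfl
    · simpa using key ![1, 0, 0]
    · simpa using key ![0, 1, 0]
    · simpa using key ![0, 0, 1]
  · rw [map_zero]
    exact Submodule.zero_mem _
  · intro η η' _ _ hη hη'
    rw [map_add]
    exact Submodule.add_mem _ hη hη'
  · intro c η _ hη
    rw [map_smul]
    exact Submodule.smul_mem _ c hη

/-- `ω_λ(v, λv) = |λ|² g₀(v, v)`: the Kähler form of `λ` is non-zero on `(v, λv)`. [cite: Joyce2007, §10.1.1 eq. (10.1)] -/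
theorem fundamentalForm_twistorOp_apply_self_twistorOp (h : IsLinearHyperkaehler g₀ J) (z : Fin 3 → ℝ) (v : E) :
    fundamentalForm g₀ (z 0 • opI E + z 1 • J + z 2 • opK J) ![v, (z 0 • opI E + z 1 • J + z 2 • opK J) v] =
      (z 0 ^ 2 + z 1 ^ 2 + z 2 ^ 2) * g₀ v v := by
  rw [h.fundamentalForm_twistorOp_apply, h.inner_twistor_left, h.twistor_apply_twistor_apply, map_neg, map_smul,
    smul_eq_mul, neg_neg]

/-- **`z ↦ ω_{λ_z}` is injective** (on a non-zero space): `ω_{λ_z} = 0` forces `z = 0`.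
[cite: Verbitsky1996Hyperholomorphic, §2 Lemma 2.1 (proof: "R is a trivial bundle … with a fiber 𝔤_M")] -/
theorem eq_zero_of_fundamentalForm_twistorOp_eq_zero [Nontrivial E] (h : IsLinearHyperkaehler g₀ J)
    {z : Fin 3 → ℝ} (hz : fundamentalForm g₀ (z 0 • opI E + z 1 • J + z 2 • opK J) = 0) : z = 0 := by
  obtain ⟨v, hv⟩ := exists_ne (0 : E)
  have e := h.fundamentalForm_twistorOp_apply_self_twistorOp z v
  rw [hz, ContinuousAlternatingMap.coe_zero, Pi.zero_apply] at e
  have hg : 0 < g₀ v v := h.pos v hv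
  have hsum : z 0 ^ 2 + z 1 ^ 2 + z 2 ^ 2 = 0 := by
    rcases mul_eq_zero.1 e.symm with h0 | h0
    · exact h0
    · exact absurd h0 hg.ne'
  have h0 : z 0 = 0 := by nlinarith [sq_nonneg (z 0), sq_nonneg (z 1), sq_nonneg (z 2)]
  have h1 : z 1 = 0 := by nlinarith [sq_nonneg (z 0), sq_nonneg (z 1), sq_nonneg (z 2)]
  have h2 : z 2 = 0 := by nlinarith [sq_nonneg (z 0), sq_nonneg (z 1), sq_nonneg (z 2)]
  ext i
  fin_cases i <;> assumption

/-- **No non-zero element of `R` is `𝔤_M`-invariant** ("Moreover, no section of `R` is `G_M`-invariant. This is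
proven by another direct computation"), at the Lie-algebra level: `ad I ω = 0 = ad J ω` and `ω ∈ R` force
`ω = 0`. [cite: Verbitsky1996Hyperholomorphic, §2 Lemma 2.1 (proof)] -/
theorem eq_zero_of_mem_span_of_adAlt_eq_zero [Nontrivial E] (h : IsLinearHyperkaehler g₀ J)
    {ω : E [⋀^Fin 2]→L[ℝ] ℝ}
    (hω : ω ∈ Submodule.span ℝ {fundamentalForm g₀ (opI E), fundamentalForm g₀ J, fundamentalForm g₀ (opK J)})
    (hI : adAlt (opI E) ω = 0) (hJ : adAlt J ω = 0) : ω = 0 := by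
  -- `ω = ω_{λ_y}` for some `y`
  obtain ⟨y, rfl⟩ : ∃ y : Fin 3 → ℝ, ω = fundamentalForm g₀ (y 0 • opI E + y 1 • J + y 2 • opK J) := by
    rw [Submodule.mem_span_insert] at hω
    obtain ⟨a, ω', hω', rfl⟩ := hω
    rw [Submodule.mem_span_pair] at hω'
    obtain ⟨b, c, rfl⟩ := hω'
    refine ⟨![a, b, c], ?_⟩
    simp only [Matrix.cons_val_zero, Matrix.cons_val_one, Matrix.cons_val_two, Matrix.head_cons, Matrix.tail_cons,
      fundamentalForm_twistor]
    abel
  have eI := h.adAlt_twistorOp_fundamentalForm_twistorOp ![1, 0, 0] y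
  have eJ := h.adAlt_twistorOp_fundamentalForm_twistorOp ![0, 1, 0] y
  simp only [Matrix.cons_val_zero, Matrix.cons_val_one, Matrix.cons_val_two, Matrix.head_cons, Matrix.tail_cons,
    one_smul, zero_smul, add_zero, zero_add] at eI eJ
  rw [hI] at eI
  rw [hJ] at eJ
  have hI' : fundamentalForm g₀ ((![1, 0, 0] ⨯₃ y) 0 • opI E + (![1, 0, 0] ⨯₃ y) 1 • J +
      (![1, 0, 0] ⨯₃ y) 2 • opK J) = 0 :=
    (smul_eq_zero.1 eI.symm).resolve_left (by norm_num)
  have hJ' : fundamentalForm g₀ ((![0, 1, 0] ⨯₃ y) 0 • opI E + (![0, 1, 0] ⨯₃ y) 1 • J +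
      (![0, 1, 0] ⨯₃ y) 2 • opK J) = 0 :=
    (smul_eq_zero.1 eJ.symm).resolve_left (by norm_num)
  have h1 := h.eq_zero_of_fundamentalForm_twistorOp_eq_zero hI'
  have h2 := h.eq_zero_of_fundamentalForm_twistorOp_eq_zero hJ'
  have hy : y = 0 := by
    have a := congr_fun h1 1
    have b := congr_fun h1 2
    have c := congr_fun h2 2
    simp only [cross_apply, Matrix.cons_val_zero, Matrix.cons_val_one, Matrix.cons_val_two, Matrix.head_cons,
      Matrix.tail_cons, Pi.zero_apply] at a b c
    have h0 : y 0 = 0 := by linarith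
    have h1' : y 1 = 0 := by linarith
    have h2' : y 2 = 0 := by linarith
    ext i
    fin_cases i <;> assumption
  rw [hy]
  simp [fundamentalForm_zero']

end IsLinearHyperkaehler

end Literature.Geometry.Hyperkaehler

end
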